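import Literature.NumberTheory.GaloisRepresentations.ArtinConductorHerbrandProofs
import Literature.NumberTheory.GaloisRepresentations.RamificationFiltrationTowerProofs
import Literature.NumberTheory.GaloisRepresentations.QuadraticEisensteinRamificationProofs
import Literature.NumberTheory.GaloisRepresentations.HeckeCharacterProofs
import HarnessLib

/-!
# The absolute upper ramification groups on a square root: `Γ_K^u(𝔓)` moves `√d` iff `u ≤ b`

`Proofs` file (theorems only, no definitions, no named facts) in topic
`NumberTheory/GaloisRepresentations`, sequel of `QuadraticEisensteinRamificationProofs`, landed
by the seat of bsd.S15 (`Literature.NumberTheory.EllipticCurves.conductorNorm_eq_artinConductorNat`)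
as the Galois side of Ogg's formula at the potentially multiplicative places above `2` of an
elliptic curve over `ℚ` (Silverman, *ATAEC*, Thm. IV.10.2(b) and its proof, case `v(j) < 0`,
PDF pp. 359–360, in residue characteristic `2`: the wild conductor of a ramified quadratic twist
of a Tate curve is twice the break of the quadratic field).

* `setOf_exists_smul_ne_eq` — for a finite normal `F/K` inside `K̄` generated by `x` and a prime
  `𝔓` of `\bar ℤ_K` above `v`: `{u > 0 : some σ ∈ Γ_K^u(𝔓) moves x} = {u > 0 : Gal(F/K)^u ≠ 1}`
  at `𝔓 ∩ F` (Herbrand: `Γ_K^u ↠ Gal(F/K)^u`,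
  `absUpperRamificationSubgroup_map_absRestrictNormalHom_holds`);
* `volume_real_setOf_smul_sqrt_ne` — for a number field `K`, `s ∈ K̄` with `s² = d ∈ 𝓞 K` not a
  square in `K`, `t₀ ∈ 𝓞 K` such that `θ = s + t₀` satisfies an Eisenstein equation
  `θ² - 2t₀θ + (t₀² - d) = 0` at `v` (`2t₀ ∈ v`, `t₀² - d ∈ v ∖ v²`), and `b` with
  `b + 1 = min (2v(2) + 1, 2v(2t₀))`: **`vol {u > 0 : Γ_K^u(𝔓) moves s} = b`**;
* over `ℚ` at `2` (`volume_real_setOf_smul_sqrt_ne_of_emod_four_eq_three/_eq_two`): `b = 1` for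
  `d ≡ 3 (mod 4)` (`θ = 1 + √d`) and `b = 2` for `d ≡ 2 (mod 4)` (`θ = √d`) — the breaks of
  `ℚ₂(√d)/ℚ₂`, i.e. conductor exponents `2` and `3`.

## References

* J.-P. Serre, *Local Fields*, GTM 67 (1979), Ch. IV §1 (Prop. 2 ff.), §3 (Prop. 14, Remark 1).
  [SerreLocalFields1979]
* J. H. Silverman, *Advanced Topics in the Arithmetic of Elliptic Curves*, GTM 151 (1994),
  Thm. IV.10.2 and its proof (PDF pp. 358–362). [SilvermanATAEC1994]
-/

noncomputable section

open scoped NumberField Pointwise IntermediateField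
open Polynomial Field IsDedekindDomain

namespace Literature.NumberTheory.GaloisRepresentations

universe u

/-! ### `Γ_K^u` moves a generator of `F` iff `Gal(F/K)^u ≠ 1` -/

section Generator

variable {K : Type u} [Field K] [NumberField K]

/-- **`Γ_K^u(𝔓)` moves `x` iff `Gal(F/K)^u(𝔓 ∩ F) ≠ 1`** for a finite normal subextension `F/K`
of `K̄` on whose elements an automorphism fixing `x ∈ F` is trivial, and `u` arbitrary: the image
of `Γ_K^u(𝔓)` in `Gal(F/K)` is `Gal(F/K)^u` (Herbrand,
`absUpperRamificationSubgroup_map_absRestrictNormalHom_holds`).  Serre, *Local Fields*, Ch. IV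
§3, Prop. 14 and Remark 1. [cite: SerreLocalFields1979, Ch. IV §3 Prop. 14 and Remark 1] -/
theorem exists_smul_ne_iff_upperRamificationSubgroup_ne_bot
    (F : IntermediateField K (AlgebraicClosure K)) [FiniteDimensional K F] [Normal K F]
    {x : AlgebraicClosure K} (hx : x ∈ F) (hgen : ∀ g : F ≃ₐ[K] F, g ⟨x, hx⟩ = ⟨x, hx⟩ → g = 1)
    {v : HeightOneSpectrum (𝓞 K)} {𝔓 : Ideal (absIntegers (𝓞 K) K)} (h𝔓 : 𝔓 ∈ v.primesAbove)
    (w : ℝ) :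
    (∃ σ ∈ absUpperRamificationSubgroup (𝓞 K) 𝔓 w, σ • x ≠ x) ↔
      upperRamificationSubgroup (𝔓.comap (F.integralClosureToAbsIntegers (𝓞 K))) (F ≃ₐ[K] F) w
        ≠ ⊥ := by
  have hres : ∀ (σ : absoluteGaloisGroup K) (y : F),
      ((absRestrictNormalHom F σ y : F) : AlgebraicClosure K) = σ • (y : AlgebraicClosure K) :=
    fun σ y ↦ AlgEquiv.restrictNormal_commutes (absoluteGaloisGroup.toAlgEquiv K σ) F y
  have hmap := absUpperRamificationSubgroup_map_absRestrictNormalHom_holds (K := K) h𝔓 F w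
  constructor
  · rintro ⟨σ, hσ, hne⟩ hbot
    have hmem : absRestrictNormalHom F σ ∈ upperRamificationSubgroup
        (𝔓.comap (F.integralClosureToAbsIntegers (𝓞 K))) (F ≃ₐ[K] F) w := by
      rw [← hmap]; exact Subgroup.mem_map_of_mem _ hσ
    rw [hbot, Subgroup.mem_bot] at hmem
    apply hne
    have := hres σ ⟨x, hx⟩
    rw [hmem, AlgEquiv.one_apply] at this
    exact this.symm
  · intro hne
    obtain ⟨g, hg, hg1⟩ : ∃ g ∈ upperRamificationSubgroup
        (𝔓.comap (F.integralClosureToAbsIntegers (𝓞 K))) (F ≃ₐ[K] F) w, g ≠ 1 := by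
      by_contra h
      push Not at h
      exact hne ((Subgroup.eq_bot_iff_forall _).mpr h)
    rw [← hmap] at hg
    obtain ⟨σ, hσ, rfl⟩ := Subgroup.mem_map.mp hg
    refine ⟨σ, hσ, fun hfix => hg1 (hgen _ ?_)⟩
    apply Subtype.ext
    rw [hres σ ⟨x, hx⟩]
    exact hfix

/-- Set form of `exists_smul_ne_iff_upperRamificationSubgroup_ne_bot`:
`{u > 0 : Γ_K^u(𝔓) moves x} = {u > 0 : Gal(F/K)^u ≠ 1}`. [cite: SerreLocalFields1979, Ch. IV §3 Prop. 14 and Remark 1] -/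
theorem setOf_exists_smul_ne_eq (F : IntermediateField K (AlgebraicClosure K))
    [FiniteDimensional K F] [Normal K F] {x : AlgebraicClosure K} (hx : x ∈ F)
    (hgen : ∀ g : F ≃ₐ[K] F, g ⟨x, hx⟩ = ⟨x, hx⟩ → g = 1)
    {v : HeightOneSpectrum (𝓞 K)} {𝔓 : Ideal (absIntegers (𝓞 K) K)} (h𝔓 : 𝔓 ∈ v.primesAbove) :
    {w : ℝ | 0 < w ∧ ∃ σ ∈ absUpperRamificationSubgroup (𝓞 K) 𝔓 w, σ • x ≠ x} =
      {w : ℝ | 0 < w ∧ upperRamificationSubgroup (𝔓.comap (F.integralClosureToAbsIntegers (𝓞 K)))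
        (F ≃ₐ[K] F) w ≠ ⊥} := by
  ext w
  simp only [Set.mem_setOf_eq]
  rw [exists_smul_ne_iff_upperRamificationSubgroup_ne_bot F hx hgen h𝔓 w]

end Generator

/-! ### `K(√d)`: the volume of `{u > 0 : Γ_K^u moves √d}` is the break `b` -/

section Sqrt

variable {K : Type u} [Field K] [NumberField K]

/-- **`vol {u > 0 : Γ_K^u(𝔓) moves √d} = b`, the break of `K(√d)` at `𝔓`.**  Let `K` be a
number field, `d, t₀ ∈ 𝓞 K` with `d` not a square in `K`, `s ∈ K̄` with `s² = d`, `v` a finite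
place and `𝔓 ∣ v` a prime of `\bar ℤ_K`.  Suppose `θ = s + t₀` satisfies an equation Eisenstein
at `v`: `θ² - 2t₀θ + (t₀² - d) = 0` with `2t₀ ∈ v`, `t₀² - d ∈ v ∖ v²`, and let
`b + 1 = min (2 ord_v 2 + 1, 2 ord_v(2t₀))`.  Then the set of `u > 0` for which the absolute upper
ramification group `Γ_K^u(𝔓)` does not fix `s` has Lebesgue measure `b`: it is
`{u > 0 : Gal(K(s)/K)^u ≠ 1}` (`setOf_exists_smul_ne_eq`), the lower filtration of the quadratic
Eisenstein extension `K(s) = K(θ)` at `𝔓 ∩ K(s)` jumps exactly at `b`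
(`ramificationSubgroup_eq_top_iff_of_quadratic`, `ord_two_mul_root_add_eq`), and so does the
upper one (`volume_real_setOf_upperRamificationSubgroup_ne_bot`).  Serre, *Local Fields*, Ch. IV
§§1, 3. [cite: SerreLocalFields1979, Ch. IV §1 Prop. 2 ff. and §3 Prop. 14, Remark 1] -/
theorem volume_real_setOf_smul_sqrt_ne {d t₀ : 𝓞 K} {s : AlgebraicClosure K}
    (hs : s ^ 2 = algebraMap K (AlgebraicClosure K) (d : K)) (hnsq : ∀ y : K, y ^ 2 ≠ (d : K))
    {v : HeightOneSpectrum (𝓞 K)} (hc₁ : 2 * t₀ ∈ v.asIdeal) (hc₀ : t₀ ^ 2 - d ∈ v.asIdeal)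
    (hc₀' : t₀ ^ 2 - d ∉ v.asIdeal ^ 2) {b : ℕ}
    (hb : min (2 * ord v.asIdeal (2 : 𝓞 K) + 1) (2 * ord v.asIdeal (2 * t₀)) = ((b + 1 : ℕ) : ℕ∞))
    {𝔓 : Ideal (absIntegers (𝓞 K) K)} (h𝔓 : 𝔓 ∈ v.primesAbove) :
    MeasureTheory.volume.real
      {w : ℝ | 0 < w ∧ ∃ σ ∈ absUpperRamificationSubgroup (𝓞 K) 𝔓 w, σ • s ≠ s} = b := by
  -- the field `F = K(s)`: quadratic, Galois
  have hsint : IsIntegral K s :=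
    IsIntegral.of_pow two_pos (by rw [hs]; exact isIntegral_algebraMap)
  haveI hFd : FiniteDimensional K K⟮s⟯ := IntermediateField.adjoin.finiteDimensional hsint
  have hirr : Irreducible (X ^ 2 - C (d : K) : K[X]) :=
    (X_pow_sub_C_irreducible_iff_of_prime Nat.prime_two).mpr fun y hy => hnsq y hy
  have hmin : minpoly K s = X ^ 2 - C (d : K) :=
    (minpoly.eq_of_irreducible_of_monic hirr (by simp [hs]) (monic_X_pow_sub_C _ two_ne_zero)).symm
  have hfin : Module.finrank K K⟮s⟯ = 2 := by
    rw [IntermediateField.adjoin.finrank hsint, hmin, natDegree_X_pow_sub_C]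
  haveI : Algebra.IsQuadraticExtension K K⟮s⟯ := ⟨hfin⟩
  haveI hGal : IsGalois K K⟮s⟯ := ⟨⟩
  have hG : Nat.card (K⟮s⟯ ≃ₐ[K] K⟮s⟯) = 2 := by rw [IsGalois.card_aut_eq_finrank, hfin]
  haveI : Finite (K⟮s⟯ ≃ₐ[K] K⟮s⟯) := Nat.finite_of_card_ne_zero (by rw [hG]; norm_num)
  -- `s` generates
  have hsF : s ∈ K⟮s⟯ := IntermediateField.mem_adjoin_simple_self K s
  have hgen : ∀ g : K⟮s⟯ ≃ₐ[K] K⟮s⟯, g ⟨s, hsF⟩ = ⟨s, hsF⟩ → g = 1 := by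
    intro g hg
    apply AlgEquiv.coe_toAlgHom_injective
    refine (IntermediateField.adjoin.powerBasis hsint).algHom_ext ?_
    rw [IntermediateField.adjoin.powerBasis_gen]
    exact hg
  -- the prime `𝔓 ∩ F`
  haveI h𝔓max : 𝔓.IsMaximal := HeightOneSpectrum.isMaximal_of_mem_primesAbove h𝔓
  set 𝔓F := 𝔓.comap ((K⟮s⟯).integralClosureToAbsIntegers (𝓞 K)) with h𝔓F
  have hunder : 𝔓F.under (𝓞 K) = v.asIdeal := by
    rw [h𝔓F, under_comap_integralClosureToAbsIntegers, ← h𝔓.2.over]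
  haveI : 𝔓F.IsMaximal := isMaximal_comap_integralClosureToAbsIntegers (𝓞 K) 𝔓 K⟮s⟯
  haveI : Finite ((𝓞 K) ⧸ 𝔓.under (𝓞 K)) := by
    rw [← h𝔓.2.over]
    exact Ideal.finiteQuotientOfFreeOfNeBot v.asIdeal v.ne_bot
  haveI := isSeparable_residue_comap (𝓞 K) 𝔓 K⟮s⟯
  have hinj : Function.Injective (algebraMap (𝓞 K) (integralClosure (𝓞 K) K⟮s⟯)) :=
    (faithfulSMul_iff_algebraMap_injective _ _).mp
      (faithfulSMul_integralClosure (𝓞 K) (K := K) (L := K⟮s⟯))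
  have h𝔓F0 : 𝔓F ≠ ⊥ := by
    intro h0
    have hmem : t₀ ^ 2 - d ∈ 𝔓F.under (𝓞 K) := by rw [hunder]; exact hc₀
    rw [Ideal.under_def, Ideal.mem_comap, h0, Ideal.mem_bot, ← map_zero (algebraMap (𝓞 K) _)] at hmem
    have := hinj hmem
    exact hc₀' (by rw [this]; exact zero_mem _)
  -- the algebraic integer `θ = s + t₀` of `F`
  have hsint' : IsIntegral (𝓞 K) (⟨s, hsF⟩ : K⟮s⟯) := by
    have h1 : IsIntegral (𝓞 K) s := IsIntegral.of_pow two_pos (by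
      rw [hs, show algebraMap K (AlgebraicClosure K) (d : K) =
        algebraMap (𝓞 K) (AlgebraicClosure K) d from rfl]
      exact isIntegral_algebraMap)
    have h2 : ((K⟮s⟯).val.restrictScalars (𝓞 K)) ⟨s, hsF⟩ = s := rfl
    rw [← h2] at h1
    exact (isIntegral_algHom_iff ((K⟮s⟯).val.restrictScalars (𝓞 K)) (K⟮s⟯).val.injective).mp h1
  set θ : integralClosure (𝓞 K) K⟮s⟯ :=
    ⟨⟨s, hsF⟩ + algebraMap (𝓞 K) K⟮s⟯ t₀, hsint'.add isIntegral_algebraMap⟩ with hθdef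
  have hθ : θ ^ 2 + algebraMap (𝓞 K) _ (-(2 * t₀)) * θ + algebraMap (𝓞 K) _ (t₀ ^ 2 - d) = 0 := by
    apply Subtype.ext
    apply Subtype.ext
    have hsF2 : ((⟨s, hsF⟩ : K⟮s⟯) : AlgebraicClosure K) ^ 2 =
        algebraMap (𝓞 K) (AlgebraicClosure K) d := hs
    have hs' : s ^ 2 = algebraMap (𝓞 K) (AlgebraicClosure K) d := hs
    show (s + algebraMap (𝓞 K) (AlgebraicClosure K) t₀) ^ 2 +
        algebraMap (𝓞 K) (AlgebraicClosure K) (-(2 * t₀)) *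
          (s + algebraMap (𝓞 K) (AlgebraicClosure K) t₀) +
        algebraMap (𝓞 K) (AlgebraicClosure K) (t₀ ^ 2 - d) = 0
    simp only [map_neg, map_mul, map_sub, map_pow, map_ofNat]
    linear_combination hs'
  -- the Eisenstein data at `𝔓 ∩ F`
  have hc₁F : -(2 * t₀) ∈ 𝔓F.under (𝓞 K) := by rw [hunder]; exact neg_mem hc₁
  have hc₀F : t₀ ^ 2 - d ∈ 𝔓F.under (𝓞 K) := by rw [hunder]; exact hc₀
  have hc₀Fsq : t₀ ^ 2 - d ∉ (𝔓F.under (𝓞 K)) ^ 2 := by rw [hunder]; exact hc₀'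
  -- the non-trivial automorphism moves `θ`
  obtain ⟨σ, hσ1⟩ : ∃ σ : K⟮s⟯ ≃ₐ[K] K⟮s⟯, σ ≠ 1 := by
    haveI : Nontrivial (K⟮s⟯ ≃ₐ[K] K⟮s⟯) := by
      rw [← Finite.one_lt_card_iff_nontrivial, hG]; norm_num
    exact exists_ne 1
  have hσθ : σ • θ ≠ θ := by
    intro h
    apply hσ1
    apply hgen
    have h' : ((σ • θ : integralClosure (𝓞 K) K⟮s⟯) : K⟮s⟯) = θ := congrArg Subtype.val h
    rw [integralClosure.coe_smul, AlgEquiv.smul_def] at h'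
    change σ (⟨s, hsF⟩ + algebraMap (𝓞 K) K⟮s⟯ t₀) = ⟨s, hsF⟩ + algebraMap (𝓞 K) K⟮s⟯ t₀ at h'
    have hfix : σ (algebraMap (𝓞 K) K⟮s⟯ t₀) = algebraMap (𝓞 K) K⟮s⟯ t₀ :=
      σ.commutes (t₀ : K)
    rw [map_add, hfix] at h'
    exact add_right_cancel h'
  -- `v_{𝔓 ∩ F}(2θ - 2t₀) = b + 1`
  have hord := ord_two_mul_root_add_eq (K := K) 𝔓F h𝔓F0 hG hθ hc₁F hc₀F hc₀Fsq
  rw [hunder, ord_neg, hb] at hord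
  have hfil := fun i => ramificationSubgroup_eq_top_iff_of_quadratic (K := K) 𝔓F h𝔓F0 hG hθ
    hc₁F hc₀F hc₀Fsq hσθ hord i
  have htop : ∀ i ≤ b, 𝔓F.ramificationSubgroup (K⟮s⟯ ≃ₐ[K] K⟮s⟯) i =
      𝔓F.ramificationSubgroup (K⟮s⟯ ≃ₐ[K] K⟮s⟯) 0 := fun i hi => by
    rw [(hfil i).1.mpr hi, (hfil 0).1.mpr (Nat.zero_le b)]
  have hbot : 𝔓F.ramificationSubgroup (K⟮s⟯ ≃ₐ[K] K⟮s⟯) (b + 1) = ⊥ :=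
    (hfil (b + 1)).2.mpr (Nat.lt_succ_self b)
  have hne : 𝔓F.ramificationSubgroup (K⟮s⟯ ≃ₐ[K] K⟮s⟯) 0 ≠ ⊥ := by
    rw [(hfil 0).1.mpr (Nat.zero_le b)]
    intro h
    have hmem : σ ∈ (⊤ : Subgroup (K⟮s⟯ ≃ₐ[K] K⟮s⟯)) := Subgroup.mem_top σ
    rw [h] at hmem
    exact hσ1 (Subgroup.mem_bot.mp hmem)
  rw [setOf_exists_smul_ne_eq K⟮s⟯ hsF hgen h𝔓]
  exact volume_real_setOf_upperRamificationSubgroup_ne_bot 𝔓F _ htop hbot hne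

end Sqrt

/-! ### Over `ℚ` at `2`: `b = 1` for `d ≡ 3 (mod 4)`, `b = 2` for `d ≡ 2 (mod 4)` -/

section RatTwo

open Rat.HeightOneSpectrum

/-- An integer `≡ 2` or `3 (mod 4)` is not the square of a rational number. [folklore] -/
theorem Rat.sq_ne_intCast_of_emod_four {d : ℤ} (hd : d % 4 = 2 ∨ d % 4 = 3) (y : ℚ) :
    y ^ 2 ≠ (d : ℚ) := by
  intro hy
  -- `y` is an integer
  have hden : (y ^ 2).den = 1 := by rw [hy]; exact Rat.den_intCast d
  rw [Rat.den_pow] at hden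
  have hy1 : y.den = 1 := by
    rcases Nat.eq_zero_or_pos y.den with h | h
    · exact absurd h y.den_nz
    · nlinarith [hden]
  have hyint : (y.num : ℚ) = y := Rat.coe_int_num_of_den_eq_one hy1
  rw [← hyint] at hy
  have hnum : y.num ^ 2 = d := by exact_mod_cast hy
  -- squares are `0` or `1 (mod 4)`
  have h0 : ∀ m : ℤ, (4 * m) % 4 = 0 := fun m => by omega
  have h1 : ∀ m : ℤ, (4 * m + 1) % 4 = 1 := fun m => by omega
  rcases Int.even_or_odd' y.num with ⟨k, hk | hk⟩
  · have : d % 4 = 0 := by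
      rw [← hnum, hk, show (2 * k) ^ 2 = 4 * (k * k) by ring, h0]
    omega
  · have : d % 4 = 1 := by
      rw [← hnum, hk, show (2 * k + 1) ^ 2 = 4 * (k * k + k) + 1 by ring, h1]
    omega

variable {v : HeightOneSpectrum (𝓞 ℚ)}

/-- At a place `v ∋ 2` of `ℚ`: `natGenerator v = 2`. [folklore] -/
theorem Rat.natGenerator_eq_two (hv : (2 : 𝓞 ℚ) ∈ v.asIdeal) : natGenerator v = 2 := by
  have h := (Rat.natCast_mem_asIdeal_iff v (n := 2)).mp (by exact_mod_cast hv)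
  exact (Nat.prime_dvd_prime_iff_eq (prime_natGenerator v) Nat.prime_two).mp h

/-- At a place `v ∋ 2` of `ℚ`: an integer lies in `v` iff it is even. [folklore] -/
theorem Rat.intCast_mem_asIdeal_iff_two_dvd (hv : (2 : 𝓞 ℚ) ∈ v.asIdeal) (n : ℤ) :
    (n : 𝓞 ℚ) ∈ v.asIdeal ↔ (2 : ℤ) ∣ n := by
  rw [Rat.intCast_mem_asIdeal_iff, Rat.natGenerator_eq_two hv]; norm_cast

/-- At a place `v ∋ 2` of `ℚ`: an integer lies in `v²` iff it is divisible by `4`. [folklore] -/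
theorem Rat.intCast_mem_asIdeal_sq_iff_four_dvd (hv : (2 : 𝓞 ℚ) ∈ v.asIdeal) (n : ℤ) :
    (n : 𝓞 ℚ) ∈ v.asIdeal ^ 2 ↔ (4 : ℤ) ∣ n := by
  rw [Rat.asIdeal_eq_span_natGenerator v, Rat.natGenerator_eq_two hv, Ideal.span_singleton_pow,
    Ideal.mem_span_singleton]
  constructor
  · rintro ⟨c, hc⟩
    refine ⟨Rat.IsIntegralClosure.intEquiv (𝓞 ℚ) c, ?_⟩
    have := congrArg (Rat.IsIntegralClosure.intEquiv (𝓞 ℚ)) hc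
    rw [map_intCast, map_mul, map_pow, map_natCast] at this
    simpa using this
  · rintro ⟨c, rfl⟩
    refine ⟨(c : 𝓞 ℚ), ?_⟩
    push_cast
    ring

/-- At a place `v ∋ 2` of `ℚ`: `ord_v(2) = 1`. [folklore] -/
theorem Rat.ord_two_eq_one (hv : (2 : 𝓞 ℚ) ∈ v.asIdeal) :
    _root_.Literature.NumberTheory.GaloisRepresentations.ord v.asIdeal (2 : 𝓞 ℚ) = 1 := by
  refine ord_eq_one _ hv fun h => ?_
  have := (Rat.intCast_mem_asIdeal_sq_iff_four_dvd hv 2).mp (by exact_mod_cast h)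
  omega

/-- **`vol {u > 0 : Γ_ℚ^u(𝔓) moves √d} = 1` for `d ≡ 3 (mod 4)`, `𝔓 ∣ 2`**: the break of
`ℚ₂(√d)/ℚ₂` is `1` (`θ = 1 + √d` is a root of the Eisenstein quadratic `X² - 2X + (1 - d)`,
`v_𝔓(2θ - 2) = v_𝔓(2√d) = 2`), i.e. its conductor exponent is `2`.  Serre, *Local Fields*,
Ch. IV §1; the case `d = -1, 3` of the proof of Silverman *ATAEC* Thm. IV.10.2(b) at `p = 2`.
[cite: SerreLocalFields1979, Ch. IV §1 Prop. 2 ff. and §3 Prop. 14, Remark 1] -/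
theorem Rat.volume_real_setOf_smul_sqrt_ne_of_emod_four_eq_three {d : ℤ} (hd : d % 4 = 3)
    {s : AlgebraicClosure ℚ} (hs : s ^ 2 = algebraMap ℚ (AlgebraicClosure ℚ) (d : ℚ))
    (hv : (2 : 𝓞 ℚ) ∈ v.asIdeal) {𝔓 : Ideal (absIntegers (𝓞 ℚ) ℚ)} (h𝔓 : 𝔓 ∈ v.primesAbove) :
    MeasureTheory.volume.real
      {w : ℝ | 0 < w ∧ ∃ σ ∈ absUpperRamificationSubgroup (𝓞 ℚ) 𝔓 w, σ • s ≠ s} = 1 := by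
  have hs' : s ^ 2 = algebraMap ℚ (AlgebraicClosure ℚ) (((d : 𝓞 ℚ) : 𝓞 ℚ) : ℚ) := by
    rw [hs]; congr 1
  have h2 := Rat.ord_two_eq_one hv
  have e : ((1 : 𝓞 ℚ) ^ 2 - (d : 𝓞 ℚ)) = ((1 - d : ℤ) : 𝓞 ℚ) := by push_cast; ring
  have hc₀ : (1 : 𝓞 ℚ) ^ 2 - (d : 𝓞 ℚ) ∈ v.asIdeal := by
    rw [e, Rat.intCast_mem_asIdeal_iff_two_dvd hv]; omega
  have hc₀' : (1 : 𝓞 ℚ) ^ 2 - (d : 𝓞 ℚ) ∉ v.asIdeal ^ 2 := by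
    rw [e, Rat.intCast_mem_asIdeal_sq_iff_four_dvd hv]; omega
  have h := volume_real_setOf_smul_sqrt_ne (K := ℚ) (t₀ := 1) (b := 1) hs'
    (Rat.sq_ne_intCast_of_emod_four (Or.inr hd)) (by rw [mul_one]; exact hv) hc₀ hc₀'
    (by rw [mul_one, h2]; rfl) h𝔓
  rw [h, Nat.cast_one]

/-- **`vol {u > 0 : Γ_ℚ^u(𝔓) moves √d} = 2` for `d ≡ 2 (mod 4)`, `𝔓 ∣ 2`**: the break of
`ℚ₂(√d)/ℚ₂` is `2` (`θ = √d` is a root of the Eisenstein quadratic `X² - d`,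
`v_𝔓(2θ) = 3`), i.e. its conductor exponent is `3`.  Serre, *Local Fields*, Ch. IV §1; the case
`d = ±2, ±6` of the proof of Silverman *ATAEC* Thm. IV.10.2(b) at `p = 2`.
[cite: SerreLocalFields1979, Ch. IV §1 Prop. 2 ff. and §3 Prop. 14, Remark 1] -/
theorem Rat.volume_real_setOf_smul_sqrt_ne_of_emod_four_eq_two {d : ℤ} (hd : d % 4 = 2)
    {s : AlgebraicClosure ℚ} (hs : s ^ 2 = algebraMap ℚ (AlgebraicClosure ℚ) (d : ℚ))
    (hv : (2 : 𝓞 ℚ) ∈ v.asIdeal) {𝔓 : Ideal (absIntegers (𝓞 ℚ) ℚ)} (h𝔓 : 𝔓 ∈ v.primesAbove) :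
    MeasureTheory.volume.real
      {w : ℝ | 0 < w ∧ ∃ σ ∈ absUpperRamificationSubgroup (𝓞 ℚ) 𝔓 w, σ • s ≠ s} = 2 := by
  have hs' : s ^ 2 = algebraMap ℚ (AlgebraicClosure ℚ) (((d : 𝓞 ℚ) : 𝓞 ℚ) : ℚ) := by
    rw [hs]; congr 1
  have h2 := Rat.ord_two_eq_one hv
  have e : ((0 : 𝓞 ℚ) ^ 2 - (d : 𝓞 ℚ)) = ((-d : ℤ) : 𝓞 ℚ) := by push_cast; ring
  have hc₀ : (0 : 𝓞 ℚ) ^ 2 - (d : 𝓞 ℚ) ∈ v.asIdeal := by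
    rw [e, Rat.intCast_mem_asIdeal_iff_two_dvd hv]; omega
  have hc₀' : (0 : 𝓞 ℚ) ^ 2 - (d : 𝓞 ℚ) ∉ v.asIdeal ^ 2 := by
    rw [e, Rat.intCast_mem_asIdeal_sq_iff_four_dvd hv]; omega
  have h := volume_real_setOf_smul_sqrt_ne (K := ℚ) (t₀ := 0) (b := 2) hs'
    (Rat.sq_ne_intCast_of_emod_four (Or.inl hd)) (by rw [mul_zero]; exact zero_mem _) hc₀ hc₀'
    (by rw [mul_zero, ord_zero, h2]; rfl) h𝔓
  rw [h, Nat.cast_ofNat]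

end RatTwo

end Literature.NumberTheory.GaloisRepresentations

end
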